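import Literature.NumberTheory.LFunctions.UniformClassGroupPNTGeneralDegreeInputs
import Literature.NumberTheory.LFunctions.UniformClassGroupPNTReduction
import HarnessLib

/-!
# Thorner–Zaman Theorem 1.4 for ideal classes of a number field of ANY degree follows from its
# `θ`-form (Theorem 5.1 for `H_K/K`) and Stark's bound

Topic `Literature/NumberTheory/LFunctions` (namespace `Literature.NumberTheory.LFunctions.NumberField`).
Everything here is PROVED (theorems only; no definitions, no named facts).

The named fact `ThornerZaman2019_classPNT_hilbertClassField`
(`UniformClassGroupPNTGeneralDegree.lean`) is the `π_C`-form of [ThornerZaman2019, Thm. 1.4] for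
`L/F = H_K/K`, `K` a number field of degree `n_K > 1`, `Q = |d_K| n_K^{n_K}`.  The printed proof
(§5, proof of Thm. 5.1) derives it from the corresponding statement for the Chebyshev function
of the class (there `ψ_C`, here `θ_C = chebyshevThetaIdealClass`) by partial summation
(Lemma 2.1, with its `O(log D_L + n_F x^{1/2}/log x)` term, and (5.2)), absorbing the secondary
errors `𝓔₀(x) ≪ x^{1/2}` by the lower bound (4.8) for the main term, which rests on Stark's bound
`λ₁ ≫ Q^{−2}` (Thm. 3.3), and on Lemma 2.4 (`log D_L ≪ Q²`, i.e. `h_K` polynomial in `Q` for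
`L = H_K`).  This file carries out exactly this reduction for general degree, with absolute
constants — the general-degree twin of `UniformClassGroupPNTReduction.lean` (imaginary quadratic
`K`, `Q = 4|d_K|`), whose field-independent transfer lemmas
(`abs_sub_exceptionalLiMain_le`, `exceptionalLiMain_ge`,
`primeIdealClassCount_eq_theta_div_log_add_integral`) it reuses:

* `junk_le_errorTermN_mul` — absorption of `26 n_K √x` into
  `errorTermN (c/2) Q n x · x Q^{−s}/(4 h log x)` for `log x ≥ (72 + 8s) log Q`, `h ≤ Q⁴`, `n_K ≤ Q`;
* `ThornerZaman2019_classPNT_hilbertClassField_of_thetaForm` — **the reduction**: the named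
  fact follows from its `θ_C`-form (the dichotomy of Thm. 5.1 for `H_K/K` with the error
  `A · errorTermN c Q n_K t` for `t ≥ Q^a`, absolute `a, c, A`) together with Stark's bound
  `1 − β₁ ≥ Q^{−s}` for the exceptional zero (absolute `s`), via Chebyshev uniformly in the field
  (`chebyshevThetaIdeal_le_mul`: `θ_K(x) ≤ n_K (log 4 + 4) x`), the uniform class number bound
  `h_K ≤ Q⁴` (`classNumber_le_condQn_pow`, TZ Lemma 2.4 / Weiss) and `n_K ≤ Q`.

What is NOT here: the `θ_C`-form itself (zero-free region, log-free zero density with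
Deuring–Heilbronn repulsion and the weighted explicit formula for the class group `L`-functions
with ABSOLUTE constants, §§3–4 of the paper) and Stark's bound — the analytic heart of
[ThornerZaman2019].

## References

* J. Thorner, A. Zaman, *A unified and improved Chebotarev density theorem*, Algebra Number
  Theory 13 (2019) 1039–1068, Thm. 1.4, Lemma 2.1, Lemma 2.4, Thm. 3.3, (4.8), Thm. 5.1 and its
  proof. [ThornerZaman2019]
-/

noncomputable section

open scoped NumberField
open Real MeasureTheory Set NumberField

namespace Literature.NumberTheory.LFunctions.NumberField

/-! ### Absorption of the secondary errors, general degree -/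

/-- **Absorption of the `O(n_K √x)` terms** (the step "`𝓔₀(x) ≪ x^{1/2}` … can be absorbed" of
the proof of [ThornerZaman2019, Thm. 5.1], for general degree): for `Q ≥ 12`, `1 ≤ h ≤ Q⁴`,
`1 ≤ n ≤ Q`, `s ≥ 0`, `c ≤ 1` and `log x ≥ (72 + 8s) log Q`:
`26 n √x ≤ errorTermN (c/2) Q m x · (x Q^{−s}/(4 h log x))`. [cite: ThornerZaman2019, proof of Thm. 5.1] -/
theorem junk_le_errorTermN_mul {Q h n s c x : ℝ} (m : ℕ) (hQ : 12 ≤ Q) (hh1 : 1 ≤ h)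
    (hhQ : h ≤ Q ^ (4 : ℕ)) (hn1 : 1 ≤ n) (hnQ : n ≤ Q) (hs : 0 ≤ s) (hc1 : c ≤ 1) (hx0 : 0 < x)
    (hx : (72 + 8 * s) * Real.log Q ≤ Real.log x) :
    26 * n * Real.sqrt x ≤
      ThornerZaman.errorTermN (c / 2) Q m x * (x * Q ^ (-s) / (4 * h * Real.log x)) := by
  have hQ0 : 0 < Q := by linarith
  have hq2 : 2 < Real.log Q := two_lt_log_twelve.trans_le (Real.log_le_log (by norm_num) hQ)
  have hq0 : 0 < Real.log Q := by linarith
  have hsq : 0 ≤ s * Real.log Q := mul_nonneg hs hq0.le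
  have hL72 : 72 * Real.log Q ≤ Real.log x := by nlinarith
  have hL0 : 0 < Real.log x := by linarith
  have hh0 : 0 < h := by linarith
  have hn0 : 0 < n := by linarith
  -- (1) the error term is at least `e^{-L/4}`
  have hE : Real.exp (-(Real.log x / 4)) ≤ ThornerZaman.errorTermN (c / 2) Q m x := by
    refine le_trans (Real.exp_le_exp.mpr ?_) (ThornerZaman.exp_le_errorTermN _ _ _ _)
    rw [neg_le_neg_iff, div_le_div_iff₀ hq0 (by norm_num)]
    nlinarith [mul_nonneg (by linarith : (0 : ℝ) ≤ Real.log Q - 2 * c) hL0.le]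
  -- (2) exponential forms
  have hsqrt : Real.sqrt x = Real.exp (Real.log x / 2) := by
    rw [Real.sqrt_eq_rpow, Real.rpow_def_of_pos hx0, show Real.log x * (1 / 2) = Real.log x / 2 by ring]
  have hQs : Q ^ (-s) = Real.exp (-(s * Real.log Q)) := by
    rw [Real.rpow_def_of_pos hQ0, show Real.log Q * -s = -(s * Real.log Q) by ring]
  have hQ5 : Q ^ (5 : ℕ) = Real.exp (5 * Real.log Q) := by
    rw [show (5 : ℝ) * Real.log Q = ((5 : ℕ) : ℝ) * Real.log Q by norm_num, Real.exp_nat_mul,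
      Real.exp_log hQ0]
  have hnh : n * h ≤ Real.exp (5 * Real.log Q) := by
    rw [← hQ5, show Q ^ (5 : ℕ) = Q * Q ^ (4 : ℕ) by ring]
    exact mul_le_mul hnQ hhQ hh0.le hQ0.le
  have hL8 : Real.log x ≤ 8 * Real.exp (Real.log x / 8) := by
    have := Real.add_one_le_exp (Real.log x / 8); linarith
  -- (3) the key exponent inequality
  have hkey : 832 * Real.exp (5 * Real.log Q + 5 * Real.log x / 8) ≤
      Real.exp (3 * Real.log x / 4 - s * Real.log Q) := by
    have h8 : (8 : ℝ) ≤ Real.log x / 8 - (5 + s) * Real.log Q := by nlinarith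
    calc 832 * Real.exp (5 * Real.log Q + 5 * Real.log x / 8)
        ≤ Real.exp 8 * Real.exp (5 * Real.log Q + 5 * Real.log x / 8) :=
          mul_le_mul_of_nonneg_right (by linarith [exp_eight_ge]) (Real.exp_nonneg _)
      _ ≤ Real.exp (Real.log x / 8 - (5 + s) * Real.log Q) *
            Real.exp (5 * Real.log Q + 5 * Real.log x / 8) :=
          mul_le_mul_of_nonneg_right (Real.exp_le_exp.mpr h8) (Real.exp_nonneg _)
      _ = Real.exp (3 * Real.log x / 4 - s * Real.log Q) := by
          rw [← Real.exp_add]; ring_nf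
  -- (4) the claim in exponential form
  have claim : 26 * n * Real.exp (Real.log x / 2) * (4 * h * Real.log x) ≤
      Real.exp (-(Real.log x / 4)) * (Real.exp (Real.log x) * Real.exp (-(s * Real.log Q))) := by
    calc 26 * n * Real.exp (Real.log x / 2) * (4 * h * Real.log x)
        = 104 * ((n * h) * Real.log x) * Real.exp (Real.log x / 2) := by ring
      _ ≤ 104 * (Real.exp (5 * Real.log Q) * (8 * Real.exp (Real.log x / 8))) *
            Real.exp (Real.log x / 2) := by
          refine mul_le_mul_of_nonneg_right (mul_le_mul_of_nonneg_left ?_ (by norm_num))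
            (Real.exp_nonneg _)
          exact mul_le_mul hnh hL8 hL0.le (Real.exp_nonneg _)
      _ = 832 * Real.exp (5 * Real.log Q + 5 * Real.log x / 8) := by
          rw [show 5 * Real.log Q + 5 * Real.log x / 8 =
            5 * Real.log Q + Real.log x / 8 + Real.log x / 2 by ring, Real.exp_add, Real.exp_add]
          ring
      _ ≤ Real.exp (3 * Real.log x / 4 - s * Real.log Q) := hkey
      _ = Real.exp (-(Real.log x / 4)) * (Real.exp (Real.log x) * Real.exp (-(s * Real.log Q))) := by
          rw [← Real.exp_add, ← Real.exp_add]; ring_nf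
  rw [Real.exp_log hx0] at claim
  -- (5) back to the goal
  have hpos : 0 < 4 * h * Real.log x := by positivity
  have hRHS : Real.exp (-(Real.log x / 4)) * (x * Q ^ (-s) / (4 * h * Real.log x)) ≤
      ThornerZaman.errorTermN (c / 2) Q m x * (x * Q ^ (-s) / (4 * h * Real.log x)) :=
    mul_le_mul_of_nonneg_right hE (div_nonneg (mul_nonneg hx0.le (Real.rpow_nonneg hQ0.le _)) hpos.le)
  refine le_trans ?_ hRHS
  rw [hsqrt, hQs, ← mul_div_assoc, le_div_iff₀ hpos]
  exact claim

/-! ### The reduction -/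

/-- **Thorner–Zaman's Theorem 1.4 for the ideal classes of a number field of any degree
`n_K > 1`, from its `θ`-form and Stark's bound.**  Suppose that with absolute constants
`a, c, A, s > 0`, for every number field `K` with `n_K = [K:ℚ] > 1` (`Q = |d_K| n_K^{n_K}`,
`h = h_K`, `E(t) = errorTermN c Q n_K t`) EITHER no real class group character has a real zero of
its `L`-function in `(1 − 1/(8 log Q), 1)` and `|θ_C(t) − t/h| ≤ A E(t) t/h` for all classes `C`
and `t ≥ Q^a`, OR there are a real `χ₁` and a real zero `β₁ ∈ (1 − 1/(8 log Q), 1)` of `L(s, χ₁)`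
with Stark's bound `1 − β₁ ≥ Q^{−s}` ([ThornerZaman2019, Thm. 3.3]) and
`|θ_C(t) − g_C(t)/h| ≤ A E(t) g_C(t)/h` for all `C`, `t ≥ Q^a`, where `g_C(t) = t − χ₁(C) t^{β₁}/β₁`
(this is [ThornerZaman2019, Thm. 5.1] for `L/K = H_K/K`, in `θ`-form).  THEN the named fact
`ThornerZaman2019_classPNT_hilbertClassField` holds (with `c₁ = max(2a, 72 + 8s)`,
`c₂ = min(c,1)/2`, `c₃ = 30A + 1`).  This is the last paragraph of the proof of
[ThornerZaman2019, Thm. 5.1] (partial summation, Lemma 2.1 with its `O(n_F x^{1/2})` term, (5.2),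
absorption of `𝓔₀(x) ≪ x^{1/2}` by (4.8), Lemma 2.4), carried out with the general-degree
inputs `chebyshevThetaIdeal_le_mul` (`θ_K ≤ n_K(log 4 + 4)x`), `classNumber_le_condQn_pow`
(`h_K ≤ Q⁴`), `finrank_le_condQn` (`n_K ≤ Q`). [cite: ThornerZaman2019, Thm. 1.4 (proof of Thm. 5.1)] -/
theorem ThornerZaman2019_classPNT_hilbertClassField_of_thetaForm
    (H : ∃ a c A s : ℝ, 0 < a ∧ 0 < c ∧ 0 < A ∧ 0 < s ∧
      ∀ (K : Type) [Field K] [NumberField K], 1 < Module.finrank ℚ K →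
        ((∀ χ : ClassGroup (𝓞 K) →* ℂˣ, χ * χ = 1 →
            ∀ β : ℝ, 1 - 1 / (8 * Real.log (ThornerZaman.condQn K)) < β → β < 1 →
              classGroupLFunction K χ β ≠ 0) ∧
          ∀ (C : ClassGroup (𝓞 K)) (t : ℝ), ThornerZaman.condQn K ^ a ≤ t →
            |chebyshevThetaIdealClass K C t - t / classNumber K| ≤
              A * ThornerZaman.errorTermN c (ThornerZaman.condQn K) (Module.finrank ℚ K) t *
                (t / classNumber K)) ∨
        ∃ (χ₁ : ClassGroup (𝓞 K) →* ℂˣ) (β₁ : ℝ), χ₁ * χ₁ = 1 ∧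
          1 - 1 / (8 * Real.log (ThornerZaman.condQn K)) < β₁ ∧ β₁ < 1 ∧
          classGroupLFunction K χ₁ β₁ = 0 ∧
          ThornerZaman.condQn K ^ (-s) ≤ 1 - β₁ ∧
          ∀ (C : ClassGroup (𝓞 K)) (t : ℝ), ThornerZaman.condQn K ^ a ≤ t →
            |chebyshevThetaIdealClass K C t -
                (t - ((χ₁ C : ℂ)).re * t ^ β₁ / β₁) / classNumber K| ≤
              A * ThornerZaman.errorTermN c (ThornerZaman.condQn K) (Module.finrank ℚ K) t *
                ((t - ((χ₁ C : ℂ)).re * t ^ β₁ / β₁) / classNumber K)) :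
    ThornerZaman2019_classPNT_hilbertClassField := by
  obtain ⟨a, c, A, s, ha, hc, hA, hs, hH⟩ := H
  have hc'0 : 0 < min c 1 := lt_min hc one_pos
  have hc'1 : min c 1 ≤ 1 := min_le_right _ _
  have hc'c : min c 1 ≤ c := min_le_left _ _
  refine ⟨max (2 * a) (72 + 8 * s), min c 1 / 2, 30 * A + 1, by positivity, by positivity,
    by positivity, ?_⟩
  intro K _ _ hK
  -- notation: the degree
  set n : ℕ := Module.finrank ℚ K with hn
  -- constants of the field
  have hQ12 : 12 ≤ ThornerZaman.condQn K := ThornerZaman.twelve_le_condQn hK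
  have hQ1 : 1 < ThornerZaman.condQn K := by linarith
  have hQ0 : 0 < ThornerZaman.condQn K := by linarith
  have hq2 : 2 < Real.log (ThornerZaman.condQn K) :=
    two_lt_log_twelve.trans_le (Real.log_le_log (by norm_num) hQ12)
  have hh1 : (1 : ℝ) ≤ classNumber K := by exact_mod_cast one_le_classNumber
  have hh0 : (0 : ℝ) < classNumber K := by linarith
  have hhQ : (classNumber K : ℝ) ≤ ThornerZaman.condQn K ^ (4 : ℕ) :=
    ThornerZaman.classNumber_le_condQn_pow hK
  have hn2 : (2 : ℝ) ≤ n := by exact_mod_cast hK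
  have hn1 : (1 : ℝ) ≤ n := by linarith
  have hnQ : (n : ℝ) ≤ ThornerZaman.condQn K := ThornerZaman.finrank_le_condQn
  -- Chebyshev, uniformly: `θ_C(t) ≤ n (log 4 + 4) t`
  have hlog4 : Real.log 4 ≤ 1.5 := by
    have : Real.log 4 = 2 * Real.log 2 := by
      rw [show (4 : ℝ) = 2 ^ 2 by norm_num, Real.log_pow]; norm_num
    rw [this]
    linarith [Real.log_two_lt_d9]
  have hlog40 : 0 ≤ Real.log 4 := Real.log_nonneg (by norm_num)
  have hB0 : (0 : ℝ) ≤ n * (Real.log 4 + 4) := by positivity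
  have hTB : ∀ (C : ClassGroup (𝓞 K)) (t : ℝ), 2 ≤ t →
      chebyshevThetaIdealClass K C t ≤ n * (Real.log 4 + 4) * t := by
    intro C t ht
    refine (chebyshevThetaIdealClass_le_chebyshevThetaIdeal C t).trans ?_
    exact_mod_cast chebyshevThetaIdeal_le_mul K (x := t) (by linarith)
  -- the error term with `c' = min c 1`, non-increasing, and dominating the one with `c`
  have hEanti : AntitoneOn (ThornerZaman.errorTermN (min c 1) (ThornerZaman.condQn K) n) (Ici 2) :=
    (ThornerZaman.errorTermN_antitoneOn hc'0.le hQ1 n).mono (Ici_subset_Ici.mpr one_le_two)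
  have hE0 : ∀ t : ℝ, 2 ≤ t → 0 ≤ ThornerZaman.errorTermN (min c 1) (ThornerZaman.condQn K) n t :=
    fun t _ ↦ (ThornerZaman.errorTermN_pos _ _ _ _).le
  have hEc : ∀ t : ℝ, 1 ≤ t → ThornerZaman.errorTermN c (ThornerZaman.condQn K) n t ≤
      ThornerZaman.errorTermN (min c 1) (ThornerZaman.condQn K) n t :=
    fun t ht ↦ ThornerZaman.errorTermN_le_of_le hc'c hQ1 n ht
  -- the range `x ≥ Q^{c₁}`
  have hrange : ∀ x : ℝ, ThornerZaman.condQn K ^ max (2 * a) (72 + 8 * s) ≤ x →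
      0 < x ∧ 256 ≤ x ∧ (max 2 (ThornerZaman.condQn K ^ a)) ^ 2 ≤ x ∧
        (72 + 8 * s) * Real.log (ThornerZaman.condQn K) ≤ Real.log x := by
    intro x hx
    have hxpos : 0 < x := lt_of_lt_of_le (Real.rpow_pos_of_pos hQ0 _) hx
    have h2a : ThornerZaman.condQn K ^ (2 * a) ≤ x :=
      (Real.rpow_le_rpow_of_exponent_le hQ1.le (le_max_left _ _)).trans hx
    have h72 : ThornerZaman.condQn K ^ (72 + 8 * s) ≤ x :=
      (Real.rpow_le_rpow_of_exponent_le hQ1.le (le_max_right _ _)).trans hx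
    have hlog : (72 + 8 * s) * Real.log (ThornerZaman.condQn K) ≤ Real.log x := by
      rw [← Real.log_rpow hQ0]
      exact Real.log_le_log (Real.rpow_pos_of_pos hQ0 _) h72
    have h256 : 256 ≤ x := by
      have hl256 : Real.log 256 ≤ Real.log x := by
        have : Real.log 256 = 8 * Real.log 2 := by
          rw [show (256 : ℝ) = 2 ^ 8 by norm_num, Real.log_pow]; norm_num
        have hsq : 0 ≤ s * Real.log (ThornerZaman.condQn K) := by positivity
        have h144 : (144 : ℝ) ≤ Real.log x := by nlinarith
        linarith [Real.log_two_lt_d9]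
      exact (Real.log_le_log_iff (by norm_num) hxpos).mp hl256
    refine ⟨hxpos, h256, ?_, hlog⟩
    rcases le_total 2 (ThornerZaman.condQn K ^ a) with hm | hm
    · rw [max_eq_right hm, ← Real.rpow_natCast, ← Real.rpow_mul hQ0.le]
      rw [show a * ((2 : ℕ) : ℝ) = 2 * a by push_cast; ring]
      exact h2a
    · rw [max_eq_left hm]
      linarith
  have hy2 : (2 : ℝ) ≤ max 2 (ThornerZaman.condQn K ^ a) := le_max_left _ _
  -- the junk constant: `3 n (log 4 + 4) + 19/h ≤ 26 n`
  have hB26 : ∀ x : ℝ, (3 * (n * (Real.log 4 + 4)) + 19 / classNumber K) * Real.sqrt x ≤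
      26 * n * Real.sqrt x := by
    intro x
    refine mul_le_mul_of_nonneg_right ?_ (Real.sqrt_nonneg _)
    have : 19 / (classNumber K : ℝ) ≤ 19 := div_le_self (by norm_num) hh1
    nlinarith
  -- the dichotomy
  rcases hH K hK with ⟨hzf, hθ⟩ | ⟨χ₁, β₁, hχ₁, hβl, hβu, hL0, hstark, hθ⟩
  · -- no exceptional zero
    refine Or.inl ⟨hzf, fun C x hx ↦ ?_⟩
    obtain ⟨hx0, hx256, hyx, hlogx⟩ := hrange x hx
    have hx2 : (2 : ℝ) ≤ x := by linarith
    have hTE : ∀ t : ℝ, max 2 (ThornerZaman.condQn K ^ a) ≤ t →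
        |chebyshevThetaIdealClass K C t - (t - 0 * t ^ (1 : ℝ) / 1) / classNumber K| ≤
          A * ThornerZaman.errorTermN (min c 1) (ThornerZaman.condQn K) n t *
            ((t - 0 * t ^ (1 : ℝ) / 1) / classNumber K) := by
      intro t ht
      have ht2 : 2 ≤ t := hy2.trans ht
      have hta : ThornerZaman.condQn K ^ a ≤ t := (le_max_right _ _).trans ht
      have h1 := hθ C t hta
      simp only [zero_mul, zero_div, sub_zero]
      refine h1.trans (mul_le_mul_of_nonneg_right (mul_le_mul_of_nonneg_left
        (hEc t (by linarith)) hA.le) (by positivity))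
    have hT := abs_sub_exceptionalLiMain_le (T := chebyshevThetaIdealClass K C)
      (E := ThornerZaman.errorTermN (min c 1) (ThornerZaman.condQn K) n)
      (P := (primeIdealClassCount K C x : ℝ)) (h := classNumber K) (θ₁ := 0) (β := 1) (A := A)
      (B := n * (Real.log 4 + 4)) (y := max 2 (ThornerZaman.condQn K ^ a)) (x := x) hh0
      (by norm_num) (by norm_num) le_rfl hA.le hB0 hy2
      (fun t _ ↦ chebyshevThetaIdealClass_nonneg C t) (hTB C) hEanti hE0 hTE hx256 hyx
      ((intervalIntegrable_iff_integrableOn_Icc_of_le hx2).mpr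
        (integrableOn_chebyshevThetaIdealClass_div K C x))
      (primeIdealClassCount_eq_theta_div_log_add_integral K C hx2)
    simp only [zero_mul, sub_zero] at hT
    rw [ThornerZaman.errorTermN_sqrt _ _ _ hx0.le] at hT
    -- absorption
    have hjunk := junk_le_errorTermN_mul n hQ12 hh1 hhQ hn1 hnQ hs.le hc'1 hx0 hlogx
    have hLi : x * ThornerZaman.condQn K ^ (-s) / (4 * classNumber K * Real.log x) ≤
        offsetLogIntegral x / classNumber K := by
      have hL : 0 < Real.log x := Real.log_pos (by linarith)
      have h1 : ThornerZaman.condQn K ^ (-s) ≤ 1 :=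
        Real.rpow_le_one_of_one_le_of_nonpos hQ1.le (by linarith)
      have h2' := div_two_mul_log_le_offsetLogIntegral hx256
      rw [div_le_div_iff₀ (by positivity) hh0]
      rw [div_le_iff₀ (by positivity)] at h2'
      have h3 : x * ThornerZaman.condQn K ^ (-s) ≤ x * 1 :=
        mul_le_mul_of_nonneg_left h1 hx0.le
      nlinarith [mul_nonneg hh0.le hL.le]
    have hE'0 : 0 ≤ ThornerZaman.errorTermN (min c 1 / 2) (ThornerZaman.condQn K) n x :=
      (ThornerZaman.errorTermN_pos _ _ _ _).le
    have hfin : (3 * (n * (Real.log 4 + 4)) + 19 / classNumber K) * Real.sqrt x ≤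
        ThornerZaman.errorTermN (min c 1 / 2) (ThornerZaman.condQn K) n x *
          (offsetLogIntegral x / classNumber K) :=
      (hB26 x).trans (hjunk.trans (mul_le_mul_of_nonneg_left hLi hE'0))
    have hmain0 : 0 ≤ A * ThornerZaman.errorTermN (min c 1 / 2) (ThornerZaman.condQn K) n x *
        (offsetLogIntegral x / classNumber K) := by
      have hL : 0 < Real.log x := Real.log_pos (by linarith)
      have : 0 ≤ offsetLogIntegral x / classNumber K :=
        div_nonneg ((div_nonneg hx0.le (by positivity)).trans
          (div_two_mul_log_le_offsetLogIntegral hx256)) hh0.le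
      positivity
    nlinarith
  · -- an exceptional zero `β₁` of the real character `χ₁`
    refine Or.inr ⟨χ₁, β₁, hχ₁, hβl, hβu, hL0, fun C x hx ↦ ?_⟩
    obtain ⟨hx0, hx256, hyx, hlogx⟩ := hrange x hx
    have hx2 : (2 : ℝ) ≤ x := by linarith
    have hθ1 : ((χ₁ C : ℂ)).re = 1 ∨ ((χ₁ C : ℂ)).re = -1 := re_classGroupChar_apply hχ₁ C
    have hθabs : |((χ₁ C : ℂ)).re| ≤ 1 := abs_re_classGroupChar_apply_le hχ₁ C
    have hβhalf : 1 / 2 < β₁ := by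
      have h16 : 1 / (8 * Real.log (ThornerZaman.condQn K)) ≤ 1 / 16 :=
        one_div_le_one_div_of_le (by norm_num) (by linarith)
      linarith
    have hTE : ∀ t : ℝ, max 2 (ThornerZaman.condQn K ^ a) ≤ t →
        |chebyshevThetaIdealClass K C t -
            (t - ((χ₁ C : ℂ)).re * t ^ β₁ / β₁) / classNumber K| ≤
          A * ThornerZaman.errorTermN (min c 1) (ThornerZaman.condQn K) n t *
            ((t - ((χ₁ C : ℂ)).re * t ^ β₁ / β₁) / classNumber K) := by
      intro t ht
      have ht2 : 2 ≤ t := hy2.trans ht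
      have hta : ThornerZaman.condQn K ^ a ≤ t := (le_max_right _ _).trans ht
      have h1 := hθ C t hta
      have hg0 : 0 ≤ (t - ((χ₁ C : ℂ)).re * t ^ β₁ / β₁) / classNumber K := by
        -- from `h1`: `0 ≤ |…| ≤ A E g/h` with `A E > 0`
        have hAE : 0 < A * ThornerZaman.errorTermN c (ThornerZaman.condQn K) n t :=
          mul_pos hA (ThornerZaman.errorTermN_pos _ _ _ _)
        refine le_of_mul_le_mul_left ?_ hAE
        rw [mul_zero]
        exact (abs_nonneg _).trans h1
      exact h1.trans (mul_le_mul_of_nonneg_right (mul_le_mul_of_nonneg_left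
        (hEc t (by linarith)) hA.le) hg0)
    have hT := abs_sub_exceptionalLiMain_le (T := chebyshevThetaIdealClass K C)
      (E := ThornerZaman.errorTermN (min c 1) (ThornerZaman.condQn K) n)
      (P := (primeIdealClassCount K C x : ℝ)) (h := classNumber K) (θ₁ := ((χ₁ C : ℂ)).re)
      (β := β₁) (A := A) (B := n * (Real.log 4 + 4)) (y := max 2 (ThornerZaman.condQn K ^ a))
      (x := x) hh0 hθabs hβhalf hβu.le hA.le hB0 hy2
      (fun t _ ↦ chebyshevThetaIdealClass_nonneg C t) (hTB C) hEanti hE0 hTE hx256 hyx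
      ((intervalIntegrable_iff_integrableOn_Icc_of_le hx2).mpr
        (integrableOn_chebyshevThetaIdealClass_div K C x))
      (primeIdealClassCount_eq_theta_div_log_add_integral K C hx2)
    rw [ThornerZaman.errorTermN_sqrt _ _ _ hx0.le] at hT
    -- absorption, using Stark's bound through `exceptionalLiMain_ge`
    have hjunk := junk_le_errorTermN_mul n hQ12 hh1 hhQ hn1 hnQ hs.le hc'1 hx0 hlogx
    have hδ1 : ThornerZaman.condQn K ^ (-s) ≤ 1 :=
      Real.rpow_le_one_of_one_le_of_nonpos hQ1.le (by linarith)
    have hG := exceptionalLiMain_ge hθ1 hβhalf hβu (Real.rpow_pos_of_pos hQ0 _) hδ1 hstark hx256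
    have hLi : x * ThornerZaman.condQn K ^ (-s) / (4 * classNumber K * Real.log x) ≤
        (offsetLogIntegral x - ((χ₁ C : ℂ)).re * offsetLogIntegral (x ^ β₁)) / classNumber K := by
      have hL : 0 < Real.log x := Real.log_pos (by linarith)
      rw [show x * ThornerZaman.condQn K ^ (-s) / (4 * classNumber K * Real.log x) =
        x * ThornerZaman.condQn K ^ (-s) / (4 * Real.log x) / classNumber K by
          field_simp]
      exact div_le_div_of_nonneg_right hG hh0.le
    have hE'0 : 0 ≤ ThornerZaman.errorTermN (min c 1 / 2) (ThornerZaman.condQn K) n x :=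
      (ThornerZaman.errorTermN_pos _ _ _ _).le
    have hfin : (3 * (n * (Real.log 4 + 4)) + 19 / classNumber K) * Real.sqrt x ≤
        ThornerZaman.errorTermN (min c 1 / 2) (ThornerZaman.condQn K) n x *
          ((offsetLogIntegral x - ((χ₁ C : ℂ)).re * offsetLogIntegral (x ^ β₁)) /
            classNumber K) :=
      (hB26 x).trans (hjunk.trans (mul_le_mul_of_nonneg_left hLi hE'0))
    have hG0 : 0 ≤ (offsetLogIntegral x - ((χ₁ C : ℂ)).re * offsetLogIntegral (x ^ β₁)) /
        classNumber K := by
      refine div_nonneg (le_trans ?_ hG) hh0.le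
      have : 0 < Real.log x := Real.log_pos (by linarith)
      positivity
    have hmain0 : 0 ≤ A * ThornerZaman.errorTermN (min c 1 / 2) (ThornerZaman.condQn K) n x *
        ((offsetLogIntegral x - ((χ₁ C : ℂ)).re * offsetLogIntegral (x ^ β₁)) /
          classNumber K) := by positivity
    nlinarith

end Literature.NumberTheory.LFunctions.NumberField

end
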